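import Literature.MathematicalPhysics.QuantumFieldTheory.Balaban1983to89.T4InteractionTransport

/-!
# T4InteractionCauchy — the raw (W2″)/(W3″) data of the NE1′ tower bound (discrete raw Hessian
domination, raw Lipschitz vector) from SLICE-HOLOMORPHY and SUP BOUNDS on a complex thickening of
the small-field box, by Cauchy estimates; term-wise localisation; the finite-range option for
(W1′b); and the end-to-end corollary

HEADLINE.  `[folklore]` throughout, 0 citations.  This leaf continues `T4InteractionTransport`
(its §5 theorem `integral_sq_sub_towerMean_le_of_graded_geometric_rawInteraction_torus_pathLaw`,
"(ES-rep-W″)" in the record `t4/T4-EST-NE1p-P2.md`).  Two groups of binders of that theorem are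
DISCRETE data on the raw interaction `Praw b h` on the raw coordinate box `D b h`:

* (W2″) `hH0 hHdom hHs0 hHs hα` — a raw pair dominator `PairDomOn (D b h) (Praw b h) (H b h)`
  (discrete mixed second differences in a raw coordinate pair, diagonal included) with column
  sums `≤ Hs b` and the smallness `4 p_b² · s_r s_c · Hs b ≤ α₀ < 1`;
* (W3″) `hG hg hGg hωb` — a raw coordinate Lipschitz vector `LipOn (D b h) (Praw b h) (G b h)`,
  `G ≤ g b`, `2 p_b · g b · s_c ≤ ω`.

The natural ANALYTIC currency for such data is: the interaction is (the real part on the real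
box of) a finite sum of terms, each depending on the coordinates of a finite support only, each
separately holomorphic in every coordinate at every point of the closed `δ`-polydisc thickening
of the (convex) real box and bounded there in modulus.  This leaf proves, as elementary complex
analysis in one variable at a time plus finite sums,

1. §1 the one-variable toolkit: Cauchy's estimate at the centre of a closed disc
   (`Complex.norm_deriv_le_of_forall_mem_sphere_norm_le`, BY NAME), the resulting Lipschitz
   bound `‖f t − f s‖ ≤ (M/r) · |t − s|` along a convex set of REAL points each carrying a closed
   disc of radius `r` on which `f` is differentiable and bounded by `M` (mean-value inequality),
   and — iterating it — the mixed second difference bound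
   `‖Φ a b − Φ a 0 − Φ 0 b + Φ 0 0‖ ≤ M/(r₁ r₂) · |a| |b|` for a separately holomorphic
   `Φ : ℂ → ℂ → ℂ` along real anchors;
2. §2 complexified configurations `toC ξ`, the closed polydisc thickening `cthick D δ` of a real
   coordinate box, and the membership bookkeeping: one-coordinate updates of real box points with
   full radius, and — for the PAIR — two additive complex shifts at HALF radius around real
   anchors running along the segments `[0,a]`, `[0,b]` (the anchors stay in the box by convexity;
   on the diagonal `l = l'` the two half-radius shifts add up to the full radius, which is why the
   pair constant below carries the factor `4`);
3. §3 ONE TERM: slice-holomorphy on `cthick D δ` and `‖Fc‖ ≤ M` there give, for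
   `F := Re ∘ Fc ∘ toC`, the raw Lipschitz vector `LipOn D F (M / δ_l)` and the raw pair dominator
   `PairDomOn D F (4M / (δ_l δ_{l'}))` (two Cauchy steps); no realness of `Fc` on the real box is
   needed (`|Re z| ≤ ‖z‖`);
4. §4 LOCALISATION: a term depending only on the coordinates in a finite set `X` (`DepOn X`) has
   Lipschitz vector `0` off `X` and pair dominator `0` unless both coordinates lie in `X`; finite
   sums of terms add (`lipOn_finset_sum`, `pairDomOn_finset_sum`); the column sums of the
   localised dominators are counted by `∑_{X ∋ l'} |X| · m_X` and `∑_{X ∋ l} m_X`;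
5. §5 the FINITE-RANGE OPTION for (W1′b): if no row of `B` charges two raw sites at distance
   `> R₀`, then `∑_j |(BᵀB) i j| · (e^{κ d(i,j)} − 1) ≤ (e^{κ R₀} − 1) · β_c β_r` (rows and
   columns) — a plug-in producing the hypotheses `hMrow/hMcol` of the parent from a range, the
   row/column sums of `|B|` and `κ`; it is NOT wired into §6 (whether the relevant Gram operator is
   finite-range is a question for the record, not for this file);
6. §6 the END-TO-END COROLLARY of the parent's §5 theorem with (W2″)/(W3″) REPLACED by: convex
   raw boxes, a radius `δr b > 0`, a finite family of terms per step with supports, complex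
   extensions, slice-holomorphy and sup bounds `m` on the thickened box, an optional residual piece
   with displayed discrete data `(H_R, Hs_R, G_R, g_R)` (take it `0` if there is none), the
   expansion identity on the real box, the localisation counts `ms1 b`, `ms2 b`, and the smallness
   `4 p_b² · s_r s_c · (4 ms2 b / δr b² + Hs_R b) ≤ α₀ < 1`, `2 p_b · (ms1 b / δr b + g_R b) · s_c ≤ ω`;
   EVERY OTHER BINDER VERBATIM, conclusion verbatim.

ORIENTATION ONLY (neither used nor asserted by any declaration; the record carries the located
pointers and their status): in print the small-field effective interactions are sums of
localised terms with small coefficients, analytic on a complex neighbourhood of the small-field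
domain; the sizes of the sup bounds, of the radii and of the localisation counts for the printed
interactions are NOT derived here and NOT cited — they stay displayed hypotheses of §6.

## Honest flags

* `[folklore]`: one-variable Cauchy estimate and mean-value inequality from Mathlib by name,
  bookkeeping of `Function.update` / `Pi.single` on finite products, finite sums, and a by-name
  application of the parent theorem.  0 citations; nothing printed is reproduced, quoted or
  claimed.  `cthick`, `DepOn` and `toC` are definitions of elementary objects; no `def … : Prop`
  of this file asserts anything about print.
* The Gram identification `hrep`, coercivity `hcoer`, localisation `hMrow/hMcol` (or, via §5, the
  range `R₀`), locality `hBr/hBc`, the raw ES sensitivities, the domination data and the sizes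
  `m`, `ms1`, `ms2`, `δr`, `H_R`, `G_R` remain DISPLAYED hypotheses; BetaPertH / (B) / (B^μ) are
  untouched and appear nowhere.
* Finite `T⁴` format throughout (finitely many raw and whitened sites and finitely many terms per
  step, finitely many steps); no infinite-volume or continuum statement is made or implied.
-/

noncomputable section

open MeasureTheory ProbabilityTheory Finset Function Matrix Metric
open scoped ENNReal

namespace Literature.MathematicalPhysics.QuantumFieldTheory.Balaban1983to89.T4InteractionCauchy

open Literature.MathematicalPhysics.QuantumFieldTheory.Balaban1983to89.T4CouplingChain
open Literature.MathematicalPhysics.QuantumFieldTheory.Balaban1983to89.T4CouplingIncoherence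
open Literature.MathematicalPhysics.QuantumFieldTheory.Balaban1983to89.T4DobrushinTensorisation
open Literature.MathematicalPhysics.QuantumFieldTheory.Balaban1983to89.T4GaussianWhitening
open Literature.MathematicalPhysics.QuantumFieldTheory.Balaban1983to89.T4WhiteningFactor
open Literature.MathematicalPhysics.QuantumFieldTheory.Balaban1983to89.T4InteractionTransport
open Literature.MathematicalPhysics.QuantumFieldTheory.Balaban1983to89.QGQInverse
open Literature.MathematicalPhysics.QuantumFieldTheory.Balaban1983to89.B4Sect5Torus

universe u v w

/-! ## §1 One complex variable: Cauchy at the centre of a closed disc, Lipschitz along real points -/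

section OneVariable

/-- `[folklore]` **Cauchy's estimate on a closed disc**: if `f` is complex differentiable at every
point of the closed disc `closedBall c r` (`r > 0`) and `‖f‖ ≤ M` there, then `‖f′(c)‖ ≤ M / r`
(Mathlib's `Complex.norm_deriv_le_of_forall_mem_sphere_norm_le`, by name). -/
theorem norm_deriv_le_of_closedBall {f : ℂ → ℂ} {c : ℂ} {r M : ℝ} (hr : 0 < r)
    (hd : ∀ w ∈ closedBall c r, DifferentiableAt ℂ f w) (hM : ∀ w ∈ closedBall c r, ‖f w‖ ≤ M) :
    ‖deriv f c‖ ≤ M / r := by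
  have hdo : DifferentiableOn ℂ f (closedBall c r) := fun w hw => (hd w hw).differentiableWithinAt
  exact Complex.norm_deriv_le_of_forall_mem_sphere_norm_le hr (hdo.diffContOnCl_ball subset_rfl)
    fun z hz => hM z (sphere_subset_closedBall hz)

/-- `[folklore]` **Lipschitz bound along real points.**  If `J ⊆ ℝ` is convex and every real
point `s ∈ J` carries a closed disc `closedBall (s : ℂ) r` (`r > 0`) on which `f` is complex
differentiable and bounded by `M`, then `‖f t − f s‖ ≤ (M / r) · |t − s|` for `s, t ∈ J`
(Cauchy's estimate at each real point, then the mean-value inequality along `J`). -/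
theorem norm_sub_le_of_closedBall_family {f : ℂ → ℂ} {J : Set ℝ} (hJ : Convex ℝ J) {r M : ℝ}
    (hr : 0 < r) (hd : ∀ s ∈ J, ∀ w ∈ closedBall (s : ℂ) r, DifferentiableAt ℂ f w)
    (hM : ∀ s ∈ J, ∀ w ∈ closedBall (s : ℂ) r, ‖f w‖ ≤ M) {s t : ℝ} (hs : s ∈ J) (ht : t ∈ J) :
    ‖f t - f s‖ ≤ M / r * |t - s| := by
  have key := hJ.norm_image_sub_le_of_norm_hasDerivWithin_le
    (f := fun x : ℝ => f x) (f' := fun x : ℝ => deriv f x)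
    (fun x hx => ((hd x hx x (mem_closedBall_self hr.le)).hasDerivAt.comp_ofReal).hasDerivWithinAt)
    (fun x hx => norm_deriv_le_of_closedBall hr (hd x hx) (hM x hx)) hs ht
  rw [Real.norm_eq_abs] at key
  exact key

/-- `[folklore]` **Mixed second difference by two Cauchy steps.**  Let `Φ : ℂ → ℂ → ℂ`.  Suppose
that for all real anchors `s ∈ [[0,a]]`, `t ∈ [[0,b]]` and all `u ∈ closedBall (s : ℂ) r₁`:
`Φ · t` is complex differentiable at `u`, and `Φ u` is complex differentiable and bounded by `M`
on `closedBall (t : ℂ) r₂`.  Then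
`‖Φ a b − Φ a 0 − Φ 0 b + Φ 0 0‖ ≤ M / (r₁ r₂) · |a| · |b|`
(the inner step bounds `w ↦ Φ u w` along `[[0,b]]`, the outer step bounds
`u ↦ Φ u b − Φ u 0` along `[[0,a]]`). -/
theorem norm_mixedDiff_le_of_closedBall_family {Φ : ℂ → ℂ → ℂ} {a b r₁ r₂ M : ℝ}
    (hr₁ : 0 < r₁) (hr₂ : 0 < r₂)
    (hdu : ∀ s ∈ Set.uIcc 0 a, ∀ u ∈ closedBall (s : ℂ) r₁, ∀ t ∈ Set.uIcc 0 b,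
      DifferentiableAt ℂ (fun u' => Φ u' t) u)
    (hdw : ∀ s ∈ Set.uIcc 0 a, ∀ u ∈ closedBall (s : ℂ) r₁, ∀ t ∈ Set.uIcc 0 b,
      ∀ w ∈ closedBall (t : ℂ) r₂, DifferentiableAt ℂ (Φ u) w)
    (hM : ∀ s ∈ Set.uIcc 0 a, ∀ u ∈ closedBall (s : ℂ) r₁, ∀ t ∈ Set.uIcc 0 b,
      ∀ w ∈ closedBall (t : ℂ) r₂, ‖Φ u w‖ ≤ M) :
    ‖Φ a b - Φ a 0 - Φ 0 b + Φ 0 0‖ ≤ M / (r₁ * r₂) * (|a| * |b|) := by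
  have h0b : (0 : ℝ) ∈ Set.uIcc 0 b := Set.left_mem_uIcc
  have hbb : b ∈ Set.uIcc 0 b := Set.right_mem_uIcc
  have h0a : (0 : ℝ) ∈ Set.uIcc 0 a := Set.left_mem_uIcc
  have haa : a ∈ Set.uIcc 0 a := Set.right_mem_uIcc
  -- inner step, coordinate `w`, radius `r₂`
  have hinner : ∀ s ∈ Set.uIcc 0 a, ∀ u ∈ closedBall (s : ℂ) r₁,
      ‖Φ u b - Φ u 0‖ ≤ M / r₂ * |b| := by
    intro s hs u hu
    have h := norm_sub_le_of_closedBall_family (f := Φ u) (convex_uIcc 0 b) hr₂ (hdw s hs u hu)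
      (hM s hs u hu) h0b hbb
    rw [Complex.ofReal_zero, sub_zero] at h
    exact h
  -- outer step, coordinate `u`, radius `r₁`
  have hd : ∀ s ∈ Set.uIcc 0 a, ∀ u ∈ closedBall (s : ℂ) r₁,
      DifferentiableAt ℂ (fun u' => Φ u' b - Φ u' 0) u := by
    intro s hs u hu
    have h1 := hdu s hs u hu b hbb
    have h2 := hdu s hs u hu 0 h0b
    rw [Complex.ofReal_zero] at h2
    exact h1.sub h2
  have key := norm_sub_le_of_closedBall_family (f := fun u' => Φ u' b - Φ u' 0) (convex_uIcc 0 a)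
    hr₁ hd hinner h0a haa
  rw [Complex.ofReal_zero, sub_zero] at key
  have e : Φ a b - Φ a 0 - Φ 0 b + Φ 0 0 = (Φ a b - Φ a 0) - (Φ 0 b - Φ 0 0) := by ring
  have hr₁0 : r₁ ≠ 0 := hr₁.ne'
  have hr₂0 : r₂ ≠ 0 := hr₂.ne'
  have ec : M / r₂ * |b| / r₁ * |a| = M / (r₁ * r₂) * (|a| * |b|) := by
    field_simp
  rw [e, ← ec]
  exact key

end OneVariable

/-! ## §2 Complexified configurations, the polydisc thickening of a box, membership bookkeeping -/

section Boxes

variable {Λ : Type w}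

/-- `[folklore]` The complexification of a real configuration. -/
def toC (ξ : Λ → ℝ) : Λ → ℂ := fun k => (ξ k : ℂ)

/-- `[folklore]` The coordinates of the complexification. -/
@[simp] theorem toC_apply (ξ : Λ → ℝ) (k : Λ) : toC ξ k = (ξ k : ℂ) := rfl

/-- `[folklore]` The closed polydisc thickening of the real coordinate box `Π_k D k` with radii
`δ k`: every coordinate lies within `δ k` of a real point of `D k`. -/
def cthick (D : Λ → Set ℝ) (δ : Λ → ℝ) : Set (Λ → ℂ) :=
  {ζ | ∀ k, ∃ x ∈ D k, dist (ζ k) (x : ℂ) ≤ δ k}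

/-- `[folklore]` Membership in the thickening, unfolded. -/
theorem mem_cthick_iff {D : Λ → Set ℝ} {δ : Λ → ℝ} {ζ : Λ → ℂ} :
    ζ ∈ cthick D δ ↔ ∀ k, ∃ x ∈ D k, dist (ζ k) (x : ℂ) ≤ δ k := Iff.rfl

/-- `[folklore]` Real box points lie in the thickening (radii `≥ 0`). -/
theorem toC_mem_cthick {D : Λ → Set ℝ} {δ : Λ → ℝ} (hδ : ∀ k, 0 ≤ δ k) {ξ : Λ → ℝ}
    (hξ : ∀ k, ξ k ∈ D k) : toC ξ ∈ cthick D δ :=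
  fun k => ⟨ξ k, hξ k, by simp [hδ k]⟩

/-- `[folklore]` Translating the unordered interval `[[0, a]]` by `x`. -/
theorem add_mem_uIcc {x s a : ℝ} (hs : s ∈ Set.uIcc 0 a) : x + s ∈ Set.uIcc x (x + a) := by
  rcases Set.mem_uIcc.mp hs with ⟨h0, h1⟩ | ⟨h0, h1⟩
  · exact Set.mem_uIcc.mpr (Or.inl ⟨by linarith, by linarith⟩)
  · exact Set.mem_uIcc.mpr (Or.inr ⟨by linarith, by linarith⟩)

variable [DecidableEq Λ]

/-- `[folklore]` Complexification commutes with an additive one-site shift. -/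
theorem toC_add_single (ξ : Λ → ℝ) (l : Λ) (a : ℝ) :
    toC (ξ + Pi.single l a) = toC ξ + Pi.single l (a : ℂ) := by
  funext k
  by_cases hk : k = l
  · subst hk; simp [toC]
  · simp [toC, hk]

/-- `[folklore]` Complexification commutes with a one-site update. -/
theorem toC_update (ξ : Λ → ℝ) (l : Λ) (t : ℝ) :
    toC (update ξ l t) = update (toC ξ) l (t : ℂ) := by
  funext k
  by_cases hk : k = l
  · subst hk; simp [toC]
  · simp [toC, hk]

variable {D : Λ → Set ℝ} {δ : Λ → ℝ}

/-- `[folklore]` Updating one coordinate of a real box point by a complex value within `δ l` of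
a real point of `D l` stays in the thickening. -/
theorem update_toC_mem_cthick (hδ : ∀ k, 0 ≤ δ k) {ξ : Λ → ℝ} (hξ : ∀ k, ξ k ∈ D k) {l : Λ}
    {s : ℝ} (hs : s ∈ D l) {w : ℂ} (hw : w ∈ closedBall (s : ℂ) (δ l)) :
    update (toC ξ) l w ∈ cthick D δ := by
  intro k
  by_cases hk : k = l
  · subst hk
    exact ⟨s, hs, by simpa only [update_self, mem_closedBall] using hw⟩
  · exact ⟨ξ k, hξ k, by simp [hk, hδ k]⟩

/-- `[folklore]` CONVEXITY STEP: if `η` and `η + a · 1_l` lie in a box with convex sides, so does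
`η + s · 1_l` for every `s` between `0` and `a`. -/
theorem add_single_mem_box (hD : ∀ k, Convex ℝ (D k)) {η : Λ → ℝ} (hη : ∀ k, η k ∈ D k)
    {l : Λ} {a : ℝ} (hηa : ∀ k, (η + Pi.single l a : Λ → ℝ) k ∈ D k) {s : ℝ}
    (hs : s ∈ Set.uIcc 0 a) : ∀ k, (η + Pi.single l s : Λ → ℝ) k ∈ D k := by
  intro k
  by_cases hk : k = l
  · subst hk
    have h1 : η k + a ∈ D k := by simpa using hηa k
    have hsub := (convex_iff_ordConnected.mp (hD k)).uIcc_subset (hη k) h1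
    simpa using hsub (add_mem_uIcc (x := η k) hs)
  · simpa [hk] using hη k

/-- `[folklore]` THE REAL ANCHOR of the pair: if the four corners `ξ`, `ξ + a·1_l`, `ξ + b·1_{l'}`,
`ξ + a·1_l + b·1_{l'}` lie in a box with convex sides, so does `ξ + s·1_l + t·1_{l'}` for `s`
between `0` and `a` and `t` between `0` and `b` (diagonal `l = l'` included). -/
theorem anchor_mem_box (hD : ∀ k, Convex ℝ (D k)) {ξ : Λ → ℝ} {l l' : Λ} {a b : ℝ}
    (h0 : ∀ k, ξ k ∈ D k) (h1 : ∀ k, (ξ + Pi.single l a : Λ → ℝ) k ∈ D k)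
    (h2 : ∀ k, (ξ + Pi.single l' b : Λ → ℝ) k ∈ D k)
    (h3 : ∀ k, (ξ + Pi.single l a + Pi.single l' b : Λ → ℝ) k ∈ D k)
    {s t : ℝ} (hs : s ∈ Set.uIcc 0 a) (ht : t ∈ Set.uIcc 0 b) :
    ∀ k, (ξ + Pi.single l s + Pi.single l' t : Λ → ℝ) k ∈ D k := by
  -- `ξ + s·1_l` lies in the box
  have p1 : ∀ k, (ξ + Pi.single l s : Λ → ℝ) k ∈ D k := add_single_mem_box hD h0 h1 hs
  -- `ξ + b·1_{l'} + s·1_l` lies in the box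
  have h3' : ∀ k, (ξ + Pi.single l' b + Pi.single l a : Λ → ℝ) k ∈ D k := by
    intro k; rw [add_right_comm]; exact h3 k
  have p2 : ∀ k, (ξ + Pi.single l' b + Pi.single l s : Λ → ℝ) k ∈ D k :=
    add_single_mem_box hD h2 h3' hs
  -- hence `ξ + s·1_l + t·1_{l'}`
  have p2' : ∀ k, (ξ + Pi.single l s + Pi.single l' b : Λ → ℝ) k ∈ D k := by
    intro k; rw [add_right_comm]; exact p2 k
  exact add_single_mem_box hD p1 p2' ht

/-- `[folklore]` A one-site vector of modulus `≤ c l` is coordinatewise `≤ c` (`c ≥ 0`). -/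
theorem norm_single_apply_le {c : Λ → ℝ} (hc : ∀ k, 0 ≤ c k) {l : Λ} {x : ℂ}
    (hx : ‖x‖ ≤ c l) (k : Λ) : ‖(Pi.single l x : Λ → ℂ) k‖ ≤ c k := by
  by_cases hk : k = l
  · subst hk; simpa using hx
  · simp [hk, hc k]

/-- `[folklore]` PAIR MEMBERSHIP AT HALF RADIUS: with the four corners in a box with convex sides,
real anchors `s ∈ [[0,a]]`, `t ∈ [[0,b]]`, and complex shifts `u`, `w` within `δ_l / 2`,
`δ_{l'} / 2` of them, the configuration `toC ξ + u·1_l + w·1_{l'}` lies in the thickening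
`cthick D δ` (radii `≥ 0`; on the diagonal the two half radii add up). -/
theorem add_single_single_mem_cthick (hD : ∀ k, Convex ℝ (D k)) (hδ : ∀ k, 0 ≤ δ k)
    {ξ : Λ → ℝ} {l l' : Λ} {a b : ℝ}
    (h0 : ∀ k, ξ k ∈ D k) (h1 : ∀ k, (ξ + Pi.single l a : Λ → ℝ) k ∈ D k)
    (h2 : ∀ k, (ξ + Pi.single l' b : Λ → ℝ) k ∈ D k)
    (h3 : ∀ k, (ξ + Pi.single l a + Pi.single l' b : Λ → ℝ) k ∈ D k)
    {s : ℝ} (hs : s ∈ Set.uIcc 0 a) {t : ℝ} (ht : t ∈ Set.uIcc 0 b)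
    {u : ℂ} (hu : u ∈ closedBall (s : ℂ) (δ l / 2)) {w : ℂ} (hw : w ∈ closedBall (t : ℂ) (δ l' / 2)) :
    toC ξ + Pi.single l u + Pi.single l' w ∈ cthick D δ := by
  have hanc := anchor_mem_box hD h0 h1 h2 h3 hs ht
  intro k
  refine ⟨(ξ + Pi.single l s + Pi.single l' t : Λ → ℝ) k, hanc k, ?_⟩
  have hdec : (toC ξ + Pi.single l u + Pi.single l' w : Λ → ℂ) k -
      (((ξ + Pi.single l s + Pi.single l' t : Λ → ℝ) k : ℝ) : ℂ) =
      (Pi.single l (u - (s : ℂ)) : Λ → ℂ) k + (Pi.single l' (w - (t : ℂ)) : Λ → ℂ) k := by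
    have e : toC (ξ + Pi.single l s + Pi.single l' t) =
        toC ξ + Pi.single l (s : ℂ) + Pi.single l' (t : ℂ) := by
      rw [toC_add_single, toC_add_single]
    have ek := congrFun e k
    simp only [toC_apply] at ek
    rw [ek]
    simp only [Pi.add_apply, Pi.single_apply]
    split_ifs <;> ring
  have hc2 : ∀ k, 0 ≤ δ k / 2 := fun k => by linarith [hδ k]
  have hu' : ‖u - (s : ℂ)‖ ≤ δ l / 2 := by rwa [mem_closedBall, dist_eq_norm] at hu
  have hw' : ‖w - (t : ℂ)‖ ≤ δ l' / 2 := by rwa [mem_closedBall, dist_eq_norm] at hw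
  calc dist ((toC ξ + Pi.single l u + Pi.single l' w : Λ → ℂ) k)
        (((ξ + Pi.single l s + Pi.single l' t : Λ → ℝ) k : ℝ) : ℂ)
      = ‖(Pi.single l (u - (s : ℂ)) : Λ → ℂ) k + (Pi.single l' (w - (t : ℂ)) : Λ → ℂ) k‖ := by
        rw [dist_eq_norm, hdec]
    _ ≤ ‖(Pi.single l (u - (s : ℂ)) : Λ → ℂ) k‖ + ‖(Pi.single l' (w - (t : ℂ)) : Λ → ℂ) k‖ :=
        norm_add_le _ _
    _ ≤ δ k / 2 + δ k / 2 :=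
        add_le_add (norm_single_apply_le hc2 hu' k) (norm_single_apply_le hc2 hw' k)
    _ = δ k := by ring

/-- `[folklore]` TRANSLATION: slice-differentiability of `Fc` at `base + u·1_l` in the coordinate
`l` is differentiability of `u' ↦ Fc (base + u'·1_l)` at `u`. -/
theorem differentiableAt_comp_add_single {Fc : (Λ → ℂ) → ℂ} (base : Λ → ℂ) (l : Λ) (u : ℂ)
    (hd : DifferentiableAt ℂ (fun w' => Fc (update (base + Pi.single l u) l w'))
      ((base + Pi.single l u : Λ → ℂ) l)) :
    DifferentiableAt ℂ (fun u' => Fc (base + Pi.single l u')) u := by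
  have hpt : (base + Pi.single l u : Λ → ℂ) l = base l + u := by simp
  have heq : (fun u' => Fc (base + Pi.single l u')) =
      (fun w' => Fc (update (base + Pi.single l u) l w')) ∘ (fun u' => base l + u') := by
    funext u'
    simp only [Function.comp_apply]
    congr 1
    funext k
    by_cases hk : k = l
    · subst hk; simp
    · simp [hk]
  rw [hpt] at hd
  rw [heq]
  exact DifferentiableAt.comp u hd ((differentiableAt_const _).add differentiableAt_id)

end Boxes

/-! ## §3 One term: Lipschitz vector and pair dominator from slice-holomorphy and a sup bound -/

section OneTerm

variable {Λ : Type w} [DecidableEq Λ] {D : Λ → Set ℝ} {δ : Λ → ℝ} {Fc : (Λ → ℂ) → ℂ} {M : ℝ}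

/-- `[folklore]` **One coordinate, one Cauchy step.**  Slice-holomorphy in the coordinate `l` on
the thickening, `‖Fc‖ ≤ M` there, `D l` convex, `δ l > 0` (all radii `≥ 0`): replacing the real
coordinate `l` of a real box point by `t ∈ D l` moves `Fc ∘ toC` by at most `(M / δ l) · |t − ξ l|`. -/
theorem norm_sub_update_le_of_sliceHol (hδ : ∀ k, 0 ≤ δ k) {l : Λ} (hδl : 0 < δ l)
    (hDl : Convex ℝ (D l))
    (hsl : ∀ ζ ∈ cthick D δ, DifferentiableAt ℂ (fun w => Fc (update ζ l w)) (ζ l))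
    (hM : ∀ ζ ∈ cthick D δ, ‖Fc ζ‖ ≤ M) {ξ : Λ → ℝ} (hξ : ∀ k, ξ k ∈ D k) {t : ℝ}
    (ht : t ∈ D l) :
    ‖Fc (toC (update ξ l t)) - Fc (toC ξ)‖ ≤ M / δ l * |t - ξ l| := by
  have hd : ∀ s ∈ D l, ∀ w ∈ closedBall (s : ℂ) (δ l),
      DifferentiableAt ℂ (fun w' => Fc (update (toC ξ) l w')) w := by
    intro s hs w hw
    have h := hsl _ (update_toC_mem_cthick hδ hξ hs hw)
    simpa only [update_idem, update_self] using h
  have hb : ∀ s ∈ D l, ∀ w ∈ closedBall (s : ℂ) (δ l), ‖Fc (update (toC ξ) l w)‖ ≤ M :=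
    fun s hs w hw => hM _ (update_toC_mem_cthick hδ hξ hs hw)
  have key := norm_sub_le_of_closedBall_family (f := fun w' => Fc (update (toC ξ) l w')) hDl
    hδl hd hb (hξ l) ht
  have e1 : update (toC ξ) l ((t : ℝ) : ℂ) = toC (update ξ l t) := (toC_update ξ l t).symm
  have e2 : update (toC ξ) l ((ξ l : ℝ) : ℂ) = toC ξ := update_eq_self l (toC ξ)
  simpa only [e1, e2] using key

/-- `[folklore]` **One pair, two Cauchy steps at half radius.**  Slice-holomorphy in the
coordinates `l` and `l'` on the thickening `cthick D δ`, `‖Fc‖ ≤ M` there, convex sides, radii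
`> 0`: the complex second difference of `Fc ∘ toC` over the four corners is at most
`4M / (δ_l δ_{l'}) · |a| · |b|`. -/
theorem norm_secondDiff_le_of_sliceHol (hD : ∀ k, Convex ℝ (D k)) (hδ : ∀ k, 0 < δ k) {l l' : Λ}
    (hsl : ∀ ζ ∈ cthick D δ, DifferentiableAt ℂ (fun w => Fc (update ζ l w)) (ζ l))
    (hsl' : ∀ ζ ∈ cthick D δ, DifferentiableAt ℂ (fun w => Fc (update ζ l' w)) (ζ l'))
    (hM : ∀ ζ ∈ cthick D δ, ‖Fc ζ‖ ≤ M) {ξ : Λ → ℝ} {a b : ℝ} (h0 : ∀ k, ξ k ∈ D k)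
    (h1 : ∀ k, (ξ + Pi.single l a : Λ → ℝ) k ∈ D k)
    (h2 : ∀ k, (ξ + Pi.single l' b : Λ → ℝ) k ∈ D k)
    (h3 : ∀ k, (ξ + Pi.single l a + Pi.single l' b : Λ → ℝ) k ∈ D k) :
    ‖Fc (toC (ξ + Pi.single l a + Pi.single l' b)) - Fc (toC (ξ + Pi.single l a)) -
        Fc (toC (ξ + Pi.single l' b)) + Fc (toC ξ)‖ ≤ 4 * M / (δ l * δ l') * (|a| * |b|) := by
  have hδ0 : ∀ k, 0 ≤ δ k := fun k => (hδ k).le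
  have hr1 : 0 < δ l / 2 := half_pos (hδ l)
  have hr2 : 0 < δ l' / 2 := half_pos (hδ l')
  have hmem : ∀ s ∈ Set.uIcc 0 a, ∀ t ∈ Set.uIcc 0 b, ∀ u ∈ closedBall (s : ℂ) (δ l / 2),
      ∀ w ∈ closedBall (t : ℂ) (δ l' / 2),
      toC ξ + Pi.single l u + Pi.single l' w ∈ cthick D δ :=
    fun s hs t ht u hu w hw => add_single_single_mem_cthick hD hδ0 h0 h1 h2 h3 hs ht hu hw
  have ecomm : ∀ u' w' : ℂ, toC ξ + Pi.single l u' + Pi.single l' w' =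
      toC ξ + Pi.single l' w' + Pi.single l u' := fun u' w' => add_right_comm _ _ _
  -- slice differentiability in `w` (coordinate `l'`) at every admissible point
  have hdw : ∀ s ∈ Set.uIcc 0 a, ∀ u ∈ closedBall (s : ℂ) (δ l / 2), ∀ t ∈ Set.uIcc 0 b,
      ∀ w ∈ closedBall (t : ℂ) (δ l' / 2),
      DifferentiableAt ℂ (fun w' => Fc (toC ξ + Pi.single l u + Pi.single l' w')) w := by
    intro s hs u hu t ht w hw
    have hz := hsl' _ (hmem s hs t ht u hu w hw)
    exact differentiableAt_comp_add_single (Fc := Fc) (toC ξ + Pi.single l u) l' w hz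
  -- slice differentiability in `u` (coordinate `l`) at every admissible point, real `t`
  have hdu : ∀ s ∈ Set.uIcc 0 a, ∀ u ∈ closedBall (s : ℂ) (δ l / 2), ∀ t ∈ Set.uIcc 0 b,
      DifferentiableAt ℂ (fun u' => Fc (toC ξ + Pi.single l u' + Pi.single l' ((t : ℝ) : ℂ)))
        u := by
    intro s hs u hu t ht
    have hz := hmem s hs t ht u hu ((t : ℝ) : ℂ) (mem_closedBall_self hr2.le)
    rw [ecomm] at hz
    have hz' := hsl _ hz
    have hdiff := differentiableAt_comp_add_single (Fc := Fc)
      (toC ξ + Pi.single l' ((t : ℝ) : ℂ)) l u hz'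
    have hfun : (fun u' => Fc (toC ξ + Pi.single l u' + Pi.single l' ((t : ℝ) : ℂ))) =
        fun u' => Fc (toC ξ + Pi.single l' ((t : ℝ) : ℂ) + Pi.single l u') := by
      funext u'; rw [ecomm]
    rw [hfun]
    exact hdiff
  have hMΦ : ∀ s ∈ Set.uIcc 0 a, ∀ u ∈ closedBall (s : ℂ) (δ l / 2), ∀ t ∈ Set.uIcc 0 b,
      ∀ w ∈ closedBall (t : ℂ) (δ l' / 2), ‖Fc (toC ξ + Pi.single l u + Pi.single l' w)‖ ≤ M :=
    fun s hs u hu t ht w hw => hM _ (hmem s hs t ht u hu w hw)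
  -- the two Cauchy steps
  have key := norm_mixedDiff_le_of_closedBall_family
    (Φ := fun u' w' => Fc (toC ξ + Pi.single l u' + Pi.single l' w')) (a := a) (b := b)
    hr1 hr2 hdu hdw hMΦ
  beta_reduce at key
  -- identify the corners
  have c3 : toC (ξ + Pi.single l a + Pi.single l' b) =
      toC ξ + Pi.single l ((a : ℝ) : ℂ) + Pi.single l' ((b : ℝ) : ℂ) := by
    rw [toC_add_single, toC_add_single]
  have c1 : toC (ξ + Pi.single l a) =
      toC ξ + Pi.single l ((a : ℝ) : ℂ) + Pi.single l' (0 : ℂ) := by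
    rw [toC_add_single, Pi.single_zero, add_zero]
  have c2 : toC (ξ + Pi.single l' b) =
      toC ξ + Pi.single l (0 : ℂ) + Pi.single l' ((b : ℝ) : ℂ) := by
    rw [toC_add_single, Pi.single_zero, add_zero]
  have c0 : toC ξ = toC ξ + Pi.single l (0 : ℂ) + Pi.single l' (0 : ℂ) := by
    rw [Pi.single_zero, Pi.single_zero, add_zero, add_zero]
  have hre : Fc (toC (ξ + Pi.single l a + Pi.single l' b)) - Fc (toC (ξ + Pi.single l a)) -
      Fc (toC (ξ + Pi.single l' b)) + Fc (toC ξ) =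
      Fc (toC ξ + Pi.single l ((a : ℝ) : ℂ) + Pi.single l' ((b : ℝ) : ℂ)) -
        Fc (toC ξ + Pi.single l ((a : ℝ) : ℂ) + Pi.single l' (0 : ℂ)) -
      Fc (toC ξ + Pi.single l (0 : ℂ) + Pi.single l' ((b : ℝ) : ℂ)) +
        Fc (toC ξ + Pi.single l (0 : ℂ) + Pi.single l' (0 : ℂ)) := by
    rw [← c3, ← c1, ← c2, ← c0]
  have hl0 : (δ l) ≠ 0 := (hδ l).ne'
  have hl'0 : (δ l') ≠ 0 := (hδ l').ne'
  have hconst : M / (δ l / 2 * (δ l' / 2)) * (|a| * |b|) = 4 * M / (δ l * δ l') * (|a| * |b|) := by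
    congr 1
    field_simp
    ring
  rw [hre, ← hconst]
  exact key

/-- `[folklore]` Real-part form of `norm_secondDiff_le_of_sliceHol` (`|Re z| ≤ ‖z‖`). -/
theorem abs_secondDiff_re_le_of_sliceHol (hD : ∀ k, Convex ℝ (D k)) (hδ : ∀ k, 0 < δ k)
    {l l' : Λ}
    (hsl : ∀ ζ ∈ cthick D δ, DifferentiableAt ℂ (fun w => Fc (update ζ l w)) (ζ l))
    (hsl' : ∀ ζ ∈ cthick D δ, DifferentiableAt ℂ (fun w => Fc (update ζ l' w)) (ζ l'))
    (hM : ∀ ζ ∈ cthick D δ, ‖Fc ζ‖ ≤ M) {ξ : Λ → ℝ} {a b : ℝ} (h0 : ∀ k, ξ k ∈ D k)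
    (h1 : ∀ k, (ξ + Pi.single l a : Λ → ℝ) k ∈ D k)
    (h2 : ∀ k, (ξ + Pi.single l' b : Λ → ℝ) k ∈ D k)
    (h3 : ∀ k, (ξ + Pi.single l a + Pi.single l' b : Λ → ℝ) k ∈ D k) :
    |(Fc (toC (ξ + Pi.single l a + Pi.single l' b))).re - (Fc (toC (ξ + Pi.single l a))).re -
        (Fc (toC (ξ + Pi.single l' b))).re + (Fc (toC ξ)).re| ≤
      4 * M / (δ l * δ l') * (|a| * |b|) := by
  have h := norm_secondDiff_le_of_sliceHol hD hδ hsl hsl' hM h0 h1 h2 h3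
  have e : (Fc (toC (ξ + Pi.single l a + Pi.single l' b))).re - (Fc (toC (ξ + Pi.single l a))).re -
      (Fc (toC (ξ + Pi.single l' b))).re + (Fc (toC ξ)).re =
      (Fc (toC (ξ + Pi.single l a + Pi.single l' b)) - Fc (toC (ξ + Pi.single l a)) -
        Fc (toC (ξ + Pi.single l' b)) + Fc (toC ξ)).re := by
    simp only [Complex.sub_re, Complex.add_re]
  rw [e]
  exact (Complex.abs_re_le_norm _).trans h

/-- `[folklore]` **(W3″) FROM ANALYTICITY, ONE TERM**: slice-holomorphy in every coordinate on the
thickening `cthick D δ` of a box with convex sides and radii `> 0`, and `‖Fc‖ ≤ M` there, give the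
raw coordinate Lipschitz vector `M / δ_l` for `Re ∘ Fc ∘ toC` on the box. -/
theorem lipOn_re_of_sliceHol (hD : ∀ k, Convex ℝ (D k)) (hδ : ∀ k, 0 < δ k)
    (hsl : ∀ ζ ∈ cthick D δ, ∀ l, DifferentiableAt ℂ (fun w => Fc (update ζ l w)) (ζ l))
    (hM : ∀ ζ ∈ cthick D δ, ‖Fc ζ‖ ≤ M) :
    LipOn D (fun ξ => (Fc (toC ξ)).re) (fun l => M / δ l) := by
  intro ξ hξ l t ht
  have h := norm_sub_update_le_of_sliceHol (fun k => (hδ k).le) (hδ l) (hD l)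
    (fun ζ hζ => hsl ζ hζ l) hM hξ ht
  have e : (Fc (toC (update ξ l t))).re - (Fc (toC ξ)).re =
      (Fc (toC (update ξ l t)) - Fc (toC ξ)).re := by simp only [Complex.sub_re]
  rw [e]
  exact (Complex.abs_re_le_norm _).trans h

/-- `[folklore]` **(W2″) FROM ANALYTICITY, ONE TERM**: under the same hypotheses the raw pair
dominator of `Re ∘ Fc ∘ toC` on the box is `4M / (δ_l δ_{l'})` (diagonal included). -/
theorem pairDomOn_re_of_sliceHol (hD : ∀ k, Convex ℝ (D k)) (hδ : ∀ k, 0 < δ k)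
    (hsl : ∀ ζ ∈ cthick D δ, ∀ l, DifferentiableAt ℂ (fun w => Fc (update ζ l w)) (ζ l))
    (hM : ∀ ζ ∈ cthick D δ, ‖Fc ζ‖ ≤ M) :
    PairDomOn D (fun ξ => (Fc (toC ξ)).re) (fun l l' => 4 * M / (δ l * δ l')) :=
  fun _ l l' _ _ h0 h1 h2 h3 => abs_secondDiff_re_le_of_sliceHol hD hδ (fun ζ hζ => hsl ζ hζ l)
    (fun ζ hζ => hsl ζ hζ l') hM h0 h1 h2 h3

end OneTerm

/-! ## §4 Localisation: terms with finite support, finite sums, column counts -/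

section Localisation

variable {Λ : Type w}

/-- `[folklore]` `DepOn X F`: `F` depends only on the coordinates in the finite set `X`. -/
def DepOn {α β : Type*} (X : Finset Λ) (F : (Λ → α) → β) : Prop :=
  ∀ ζ ζ' : Λ → α, (∀ k ∈ X, ζ k = ζ' k) → F ζ = F ζ'

/-- `[folklore]` `Re ∘ Fc ∘ toC` inherits the support of `Fc`. -/
theorem DepOn.re_toC {X : Finset Λ} {Fc : (Λ → ℂ) → ℂ} (h : DepOn X Fc) :
    DepOn X (fun ξ : Λ → ℝ => (Fc (toC ξ)).re) := by
  intro ξ ξ' hξ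
  have e : Fc (toC ξ) = Fc (toC ξ') := h _ _ fun k hk => by simp [toC, hξ k hk]
  simp only [e]

variable [DecidableEq Λ]

/-- `[folklore]` An additive shift off the support is invisible. -/
theorem DepOn.apply_add_single {α β : Type*} [AddZeroClass α] {X : Finset Λ} {F : (Λ → α) → β}
    (h : DepOn X F) {l : Λ} (hl : l ∉ X) (ζ : Λ → α) (a : α) :
    F (ζ + Pi.single l a) = F ζ :=
  h _ _ fun k hk => by
    have hkl : k ≠ l := fun e => hl (e ▸ hk)
    simp [hkl]

/-- `[folklore]` An update off the support is invisible. -/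
theorem DepOn.apply_update {α β : Type*} {X : Finset Λ} {F : (Λ → α) → β} (h : DepOn X F)
    {l : Λ} (hl : l ∉ X) (ζ : Λ → α) (a : α) : F (update ζ l a) = F ζ :=
  h _ _ fun k hk => by
    have hkl : k ≠ l := fun e => hl (e ▸ hk)
    simp [hkl]

variable {D : Λ → Set ℝ}

/-- `[folklore]` Enlarging a Lipschitz vector. -/
theorem lipOn_of_le {F : (Λ → ℝ) → ℝ} {c c' : Λ → ℝ} (hF : LipOn D F c) (hc : ∀ l, c l ≤ c' l) :
    LipOn D F c' :=
  fun ξ hξ l t ht => (hF ξ hξ l t ht).trans (mul_le_mul_of_nonneg_right (hc l) (abs_nonneg _))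

/-- `[folklore]` Lipschitz vectors add. -/
theorem lipOn_add {F F₂ : (Λ → ℝ) → ℝ} {c c₂ : Λ → ℝ} (h₁ : LipOn D F c) (h₂ : LipOn D F₂ c₂) :
    LipOn D (fun ξ => F ξ + F₂ ξ) (fun l => c l + c₂ l) := by
  intro ξ hξ l t ht
  calc |F (update ξ l t) + F₂ (update ξ l t) - (F ξ + F₂ ξ)|
      = |(F (update ξ l t) - F ξ) + (F₂ (update ξ l t) - F₂ ξ)| := by congr 1; ring
    _ ≤ |F (update ξ l t) - F ξ| + |F₂ (update ξ l t) - F₂ ξ| := abs_add_le _ _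
    _ ≤ c l * |t - ξ l| + c₂ l * |t - ξ l| := add_le_add (h₁ ξ hξ l t ht) (h₂ ξ hξ l t ht)
    _ = (c l + c₂ l) * |t - ξ l| := by ring

/-- `[folklore]` Functions agreeing on the box share their Lipschitz vectors. -/
theorem lipOn_congr {F F' : (Λ → ℝ) → ℝ} {c : Λ → ℝ} (hF : LipOn D F c)
    (hFF' : ∀ ξ : Λ → ℝ, (∀ k, ξ k ∈ D k) → F ξ = F' ξ) : LipOn D F' c := by
  intro ξ hξ l t ht
  have hξ' : ∀ k, update ξ l t k ∈ D k := by
    intro k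
    by_cases hk : k = l
    · subst hk; simpa using ht
    · simpa [hk] using hξ k
  rw [← hFF' ξ hξ, ← hFF' _ hξ']
  exact hF ξ hξ l t ht

/-- `[folklore]` Finite sums of Lipschitz vectors. -/
theorem lipOn_finset_sum {ι' : Type*} (s : Finset ι') {f : ι' → (Λ → ℝ) → ℝ} {cf : ι' → Λ → ℝ}
    (h : ∀ x ∈ s, LipOn D (f x) (cf x)) :
    LipOn D (fun ξ => ∑ x ∈ s, f x ξ) (fun l => ∑ x ∈ s, cf x l) := by
  intro ξ hξ l t ht
  rw [← Finset.sum_sub_distrib, Finset.sum_mul]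
  exact (Finset.abs_sum_le_sum_abs _ _).trans
    (Finset.sum_le_sum fun x hx => h x hx ξ hξ l t ht)

/-- `[folklore]` Functions agreeing on the box share their pair dominators. -/
theorem pairDomOn_congr {F F' : (Λ → ℝ) → ℝ} {H : Λ → Λ → ℝ} (hF : PairDomOn D F H)
    (hFF' : ∀ ξ : Λ → ℝ, (∀ k, ξ k ∈ D k) → F ξ = F' ξ) : PairDomOn D F' H := by
  intro ξ l l' a b h0 h1 h2 h3
  rw [← hFF' _ h0, ← hFF' _ h1, ← hFF' _ h2, ← hFF' _ h3]
  exact hF ξ l l' a b h0 h1 h2 h3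

/-- `[folklore]` Finite sums of pair dominators. -/
theorem pairDomOn_finset_sum {ι' : Type*} (s : Finset ι') {f : ι' → (Λ → ℝ) → ℝ}
    {Hf : ι' → Λ → Λ → ℝ} (h : ∀ x ∈ s, PairDomOn D (f x) (Hf x)) :
    PairDomOn D (fun ξ => ∑ x ∈ s, f x ξ) (fun l l' => ∑ x ∈ s, Hf x l l') := by
  intro ξ l l' a b h0 h1 h2 h3
  have e : ∑ x ∈ s, f x (ξ + Pi.single l a + Pi.single l' b) - ∑ x ∈ s, f x (ξ + Pi.single l a) -
      ∑ x ∈ s, f x (ξ + Pi.single l' b) + ∑ x ∈ s, f x ξ =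
      ∑ x ∈ s, (f x (ξ + Pi.single l a + Pi.single l' b) - f x (ξ + Pi.single l a) -
        f x (ξ + Pi.single l' b) + f x ξ) := by
    simp only [Finset.sum_add_distrib, Finset.sum_sub_distrib]
  rw [e, Finset.sum_mul]
  exact (Finset.abs_sum_le_sum_abs _ _).trans
    (Finset.sum_le_sum fun x hx => h x hx ξ l l' a b h0 h1 h2 h3)

variable {δ : Λ → ℝ} {Fc : (Λ → ℂ) → ℂ} {M : ℝ} {X : Finset Λ}

/-- `[folklore]` **(W3″) ONE LOCALISED TERM**: a term supported on `X`, slice-holomorphic in the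
coordinates of `X` on the thickening and bounded there by `M`, has Lipschitz vector
`1_X(l) · M / δ_l`. -/
theorem lipOn_re_of_sliceHol_depOn (hdep : DepOn X Fc) (hD : ∀ k, Convex ℝ (D k))
    (hδ : ∀ k, 0 < δ k)
    (hsl : ∀ ζ ∈ cthick D δ, ∀ l ∈ X, DifferentiableAt ℂ (fun w => Fc (update ζ l w)) (ζ l))
    (hM : ∀ ζ ∈ cthick D δ, ‖Fc ζ‖ ≤ M) :
    LipOn D (fun ξ => (Fc (toC ξ)).re) (fun l => if l ∈ X then M / δ l else 0) := by
  intro ξ hξ l t ht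
  dsimp only
  by_cases hl : l ∈ X
  · rw [if_pos hl]
    have h := norm_sub_update_le_of_sliceHol (fun k => (hδ k).le) (hδ l) (hD l)
      (fun ζ hζ => hsl ζ hζ l hl) hM hξ ht
    have e : (Fc (toC (update ξ l t))).re - (Fc (toC ξ)).re =
        (Fc (toC (update ξ l t)) - Fc (toC ξ)).re := by simp only [Complex.sub_re]
    rw [e]
    exact (Complex.abs_re_le_norm _).trans h
  · have e : (Fc (toC (update ξ l t))).re = (Fc (toC ξ)).re := (hdep.re_toC).apply_update hl ξ t
    rw [if_neg hl, e, sub_self, abs_zero, zero_mul]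

/-- `[folklore]` **(W2″) ONE LOCALISED TERM**: the pair dominator of such a term is
`1_X(l) 1_X(l') · 4M / (δ_l δ_{l'})`. -/
theorem pairDomOn_re_of_sliceHol_depOn (hdep : DepOn X Fc) (hD : ∀ k, Convex ℝ (D k))
    (hδ : ∀ k, 0 < δ k)
    (hsl : ∀ ζ ∈ cthick D δ, ∀ l ∈ X, DifferentiableAt ℂ (fun w => Fc (update ζ l w)) (ζ l))
    (hM : ∀ ζ ∈ cthick D δ, ‖Fc ζ‖ ≤ M) :
    PairDomOn D (fun ξ => (Fc (toC ξ)).re)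
      (fun l l' => if l ∈ X ∧ l' ∈ X then 4 * M / (δ l * δ l') else 0) := by
  intro ξ l l' a b h0 h1 h2 h3
  dsimp only
  have hd := hdep.re_toC
  by_cases hl : l ∈ X
  · by_cases hl' : l' ∈ X
    · rw [if_pos ⟨hl, hl'⟩]
      exact abs_secondDiff_re_le_of_sliceHol hD hδ (fun ζ hζ => hsl ζ hζ l hl)
        (fun ζ hζ => hsl ζ hζ l' hl') hM h0 h1 h2 h3
    · rw [if_neg fun h => hl' h.2]
      have e1 : (Fc (toC (ξ + Pi.single l a + Pi.single l' b))).re =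
          (Fc (toC (ξ + Pi.single l a))).re := hd.apply_add_single hl' (ξ + Pi.single l a) b
      have e2 : (Fc (toC (ξ + Pi.single l' b))).re = (Fc (toC ξ)).re :=
        hd.apply_add_single hl' ξ b
      rw [e1, e2]
      have : (Fc (toC (ξ + Pi.single l a))).re - (Fc (toC (ξ + Pi.single l a))).re -
          (Fc (toC ξ)).re + (Fc (toC ξ)).re = 0 := by ring
      rw [this, abs_zero, zero_mul]
  · rw [if_neg fun h => hl h.1]
    have e1 : (Fc (toC (ξ + Pi.single l a + Pi.single l' b))).re =
        (Fc (toC (ξ + Pi.single l' b))).re := by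
      rw [add_right_comm]; exact hd.apply_add_single hl (ξ + Pi.single l' b) a
    have e2 : (Fc (toC (ξ + Pi.single l a))).re = (Fc (toC ξ)).re := hd.apply_add_single hl ξ a
    rw [e1, e2]
    have : (Fc (toC (ξ + Pi.single l' b))).re - (Fc (toC ξ)).re -
        (Fc (toC (ξ + Pi.single l' b))).re + (Fc (toC ξ)).re = 0 := by ring
    rw [this, abs_zero, zero_mul]

/-- `[folklore]` COLUMN COUNT of a localised pair dominator:
`∑_l 1_X(l) 1_X(l') · c = 1_X(l') · |X| · c`. -/
theorem sum_ite_and_mem [Fintype Λ] (X : Finset Λ) (c : ℝ) (l' : Λ) :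
    ∑ l, (if l ∈ X ∧ l' ∈ X then c else 0) = if l' ∈ X then (X.card : ℝ) * c else 0 := by
  by_cases hl' : l' ∈ X
  · simp only [hl', and_true, if_true]
    rw [Finset.sum_ite_mem, Finset.univ_inter, Finset.sum_const, nsmul_eq_mul]
  · simp [hl']

end Localisation

/-! ## §5 The finite-range option for (W1′b) -/

section FiniteRange

variable {m' : Type*} {Λ' : Type*} [Fintype m']

/-- `[folklore]` **Termwise range bound.**  If no row of `B` charges two sites `l, l'` with
`dd l l' > R₀`, then every entry of the Gram matrix `BᵀB` satisfies
`|(BᵀB) l l'| · (e^{κ dd l l'} − 1) ≤ |(BᵀB) l l'| · (e^{κ R₀} − 1)` (`κ ≥ 0`). -/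
theorem abs_gram_mul_expWeight_le_of_range (B : Matrix m' Λ' ℝ) (dd : Λ' → Λ' → ℝ) {κ R₀ : ℝ}
    (hκ : 0 ≤ κ) (hR : ∀ i l l', B i l ≠ 0 → B i l' ≠ 0 → dd l l' ≤ R₀) (l l' : Λ') :
    |(Bᵀ * B) l l'| * (Real.exp (κ * dd l l') - 1) ≤ |(Bᵀ * B) l l'| * (Real.exp (κ * R₀) - 1) := by
  by_cases h0 : (Bᵀ * B) l l' = 0
  · rw [h0, abs_zero, zero_mul, zero_mul]
  · have hex : ∃ i, B i l ≠ 0 ∧ B i l' ≠ 0 := by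
      by_contra hne
      apply h0
      rw [Matrix.mul_apply]
      refine Finset.sum_eq_zero fun i _ => ?_
      rw [Matrix.transpose_apply]
      by_cases hi : B i l = 0
      · rw [hi, zero_mul]
      · have hi' : B i l' = 0 := by
          by_contra h'
          exact hne ⟨i, hi, h'⟩
        rw [hi', mul_zero]
    obtain ⟨i, hil, hil'⟩ := hex
    refine mul_le_mul_of_nonneg_left ?_ (abs_nonneg _)
    exact sub_le_sub_right (Real.exp_le_exp.mpr (mul_le_mul_of_nonneg_left (hR i l l' hil hil') hκ)) 1

variable [Fintype Λ']

/-- `[folklore]` **(W1′b) FROM A FINITE RANGE, ROWS**: with the range hypothesis, `κ ≥ 0`,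
`R₀ ≥ 0`, row sums of `|B|` at most `β_r ≥ 0` and column sums at most `β_c`,
`∑_{l'} |(BᵀB) l l'| · (e^{κ dd l l'} − 1) ≤ (e^{κ R₀} − 1) · β_c β_r`. -/
theorem rowSum_gram_expWeight_le_of_range (B : Matrix m' Λ' ℝ) (dd : Λ' → Λ' → ℝ)
    {κ R₀ βr βc : ℝ} (hκ : 0 ≤ κ) (hR₀ : 0 ≤ R₀)
    (hR : ∀ i l l', B i l ≠ 0 → B i l' ≠ 0 → dd l l' ≤ R₀)
    (hβr : 0 ≤ βr) (hBr : ∀ i, ∑ l, |B i l| ≤ βr) (hBc : ∀ l, ∑ i, |B i l| ≤ βc) (l : Λ') :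
    ∑ l', |(Bᵀ * B) l l'| * (Real.exp (κ * dd l l') - 1) ≤ (Real.exp (κ * R₀) - 1) * (βc * βr) := by
  have hw : 0 ≤ Real.exp (κ * R₀) - 1 := sub_nonneg.mpr (Real.one_le_exp (mul_nonneg hκ hR₀))
  have hrow : ∑ l', |(Bᵀ * B) l l'| ≤ βc * βr :=
    rowSum_mul_le Bᵀ B hβr (fun k => by rw [sum_abs_transpose_apply]; exact hBc k) hBr l
  calc ∑ l', |(Bᵀ * B) l l'| * (Real.exp (κ * dd l l') - 1)
      ≤ ∑ l', |(Bᵀ * B) l l'| * (Real.exp (κ * R₀) - 1) :=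
        Finset.sum_le_sum fun l' _ => abs_gram_mul_expWeight_le_of_range B dd hκ hR l l'
    _ = (Real.exp (κ * R₀) - 1) * ∑ l', |(Bᵀ * B) l l'| := by rw [← Finset.sum_mul, mul_comm]
    _ ≤ (Real.exp (κ * R₀) - 1) * (βc * βr) := mul_le_mul_of_nonneg_left hrow hw

/-- `[folklore]` **(W1′b) FROM A FINITE RANGE, COLUMNS**: the same bound for the column sums
`∑_{l} |(BᵀB) l l'| · (e^{κ dd l l'} − 1)`. -/
theorem colSum_gram_expWeight_le_of_range (B : Matrix m' Λ' ℝ) (dd : Λ' → Λ' → ℝ)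
    {κ R₀ βr βc : ℝ} (hκ : 0 ≤ κ) (hR₀ : 0 ≤ R₀)
    (hR : ∀ i l l', B i l ≠ 0 → B i l' ≠ 0 → dd l l' ≤ R₀)
    (hβr : 0 ≤ βr) (hBr : ∀ i, ∑ l, |B i l| ≤ βr) (hBc : ∀ l, ∑ i, |B i l| ≤ βc) (l' : Λ') :
    ∑ l, |(Bᵀ * B) l l'| * (Real.exp (κ * dd l l') - 1) ≤ (Real.exp (κ * R₀) - 1) * (βc * βr) := by
  have hw : 0 ≤ Real.exp (κ * R₀) - 1 := sub_nonneg.mpr (Real.one_le_exp (mul_nonneg hκ hR₀))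
  have hcol : ∑ l, |(Bᵀ * B) l l'| ≤ βr * βc :=
    colSum_mul_le Bᵀ B hβr (fun i => by simp_rw [Matrix.transpose_apply]; exact hBr i) hBc l'
  calc ∑ l, |(Bᵀ * B) l l'| * (Real.exp (κ * dd l l') - 1)
      ≤ ∑ l, |(Bᵀ * B) l l'| * (Real.exp (κ * R₀) - 1) :=
        Finset.sum_le_sum fun l _ => abs_gram_mul_expWeight_le_of_range B dd hκ hR l l'
    _ = (Real.exp (κ * R₀) - 1) * ∑ l, |(Bᵀ * B) l l'| := by rw [← Finset.sum_mul, mul_comm]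
    _ ≤ (Real.exp (κ * R₀) - 1) * (βc * βr) := by
        rw [mul_comm βc βr]
        exact mul_le_mul_of_nonneg_left hcol hw

end FiniteRange

/-! ## §6 The NE1′ tower bound with (W2″)/(W3″) from analyticity on the thickened box -/

section EndToEnd

open Preorder MeasureTheory.Filtration

variable {X : ℕ → Type*} [∀ n, MeasurableSpace (X n)]

open scoped Classical in
/-- `[folklore]` **NE1′ TOWER BOUND, GRAM-WHITENED GIBBS FORM, (W2″)/(W3″) FROM ANALYTICITY OF
LOCALISED TERMS ON THE THICKENED RAW BOX.**  This is
`T4InteractionTransport.integral_sq_sub_towerMean_le_of_graded_geometric_rawInteraction_torus_pathLaw`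
with its raw discrete data (W2″) `(H, hH0, hHdom, Hs, hHs0, hHs)` and (W3″) `(G, hG, g, hg, hGg)`
REPLACED by:

* convex raw boxes `D b h l` and a radius `δr b > 0`;
* per performed step `b < n` and history `h`, finitely many terms `t : Tm b` with supports
  `supp b h t`, complex extensions `Fc b h t` depending only on the coordinates of the support,
  complex differentiable in each coordinate of the support at every point of the closed
  `δr b`-polydisc thickening `cthick (D b h) (δr b)` of the box, and bounded there in modulus by
  `mX b h t ≥ 0`;
* an optional residual piece `Pres b h` with DISPLAYED discrete data `(HR, HsR, GR, gR)` exactly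
  as in the parent (take `Pres = 0`, `HR = 0`, `GR = 0` if there is none);
* the expansion `Praw b h ξ = ∑_t Re (Fc b h t (ξ)) + Pres b h ξ` on the real box;
* the localisation counts `∑_{t : supp ∋ l} mX ≤ ms1 b` and `∑_{t : supp ∋ l'} |supp| · mX ≤ ms2 b`;
* the smallness `4 p_b² · s_r s_c · (4 ms2 b / δr b² + HsR b) ≤ α₀ < 1` and
  `2 p_b · (ms1 b / δr b + gR b) · s_c ≤ ω` (`s_r = (γ−ρ)⁻¹Nβ_c`, `s_c = (γ−ρ)⁻¹Nβ_r`).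

The raw pair dominator fed to the parent is `∑_t 1_{supp}(l) 1_{supp}(l') · 4 mX / δr² + HR`
(§3–§4: two Cauchy steps at half radius) and the raw Lipschitz vector is
`∑_t 1_{supp}(l) · mX / δr + GR` (one Cauchy step).  Every other binder — path law, kernels, Gram
representation `hrep`, coercivity, localisation `hMrow/hMcol`, locality of `B`, raw ES
sensitivities, domination, graded-geometric profile — is passed VERBATIM, and the conclusion is
that of the parent. -/
theorem integral_sq_sub_towerMean_le_of_graded_geometric_analyticInteraction_torus_pathLaw
    (μ : Measure (Π n, X n)) [IsFiniteMeasure μ]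
    (κ' : (b : ℕ) → Kernel (Π i : Iic b, X i) (X (b + 1))) [∀ b, IsMarkovKernel (κ' b)]
    (hκ' : ∀ b, μ.map (frestrictLe b) ⊗ₘ κ' b = μ.map (fun x => (frestrictLe b x, x (b + 1))))
    (n : ℕ) {φ : (Π k, X k) → ℝ} (hφn : StronglyMeasurable[piLE (X := X) n] φ) {R : ℝ}
    (hφR : ∀ x, |φ x| ≤ R)
    {Λ : ℕ → Type w} [∀ b, Fintype (Λ b)] [∀ b, DecidableEq (Λ b)]
    {ι : ℕ → Type u} [∀ b, Fintype (ι b)] [∀ b, DecidableEq (ι b)] {E : (b : ℕ) → ι b → Type v}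
    [∀ b i, MeasurableSpace (E b i)]
    {T : (b : ℕ) → (Π i : Iic b, X i) → (Λ b → ℝ) → X (b + 1)} (hT : ∀ b h, Measurable (T b h))
    (m : (b : ℕ) → (Π i : Iic b, X i) → Λ b → ℝ)
    (Bm : (b : ℕ) → (Π i : Iic b, X i) → Matrix (ι b) (Λ b) ℝ)
    {e : (b : ℕ) → (i : ι b) → E b i → ℝ} (he : ∀ b i, Measurable (e b i))
    {p : ℕ → ℝ} (hep : ∀ b i x, |e b i x| ≤ p b)
    (π : (b : ℕ) → (Π i : Iic b, X i) → (i : ι b) → Measure (E b i))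
    [∀ b h i, IsProbabilityMeasure (π b h i)] {v : ℝ} (hv0 : 0 ≤ v)
    (hv : ∀ b h i, ∫ y, e b i y ^ 2 ∂(π b h i) ≤ v)
    -- the RAW interaction on a raw box containing the image of the whitened configurations
    {D : (b : ℕ) → (Π i : Iic b, X i) → Λ b → Set ℝ}
    (hD : ∀ b < n, ∀ h η l, affine (m b h) (whiteningFactor (Bm b h)) (e b) η l ∈ D b h l)
    (Praw : (b : ℕ) → (Π i : Iic b, X i) → (Λ b → ℝ) → ℝ)
    (hPm : ∀ b < n, ∀ h, Measurable (Praw b h))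
    {a : (b : ℕ) → (Π i : Iic b, X i) → ℝ}
    (hPb : ∀ b < n, ∀ h ξ, (∀ l, ξ l ∈ D b h l) → |Praw b h ξ| ≤ a b h)
    (hrep : ∀ b < n, ∀ h, κ' b h =
      (gibbsMeasure (π b h)
          (fun η => Praw b h (affine (m b h) (whiteningFactor (Bm b h)) (e b) η))).map
        (fun η => T b h (affine (m b h) (whiteningFactor (Bm b h)) (e b) η)))
    -- (W2″)/(W3″) FROM ANALYTICITY: convex boxes, a radius, localised terms with complex
    -- extensions, slice-holomorphy and sup bounds on the thickened box, a residual piece with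
    -- displayed discrete data, the expansion on the real box, the localisation counts
    (hDc : ∀ b < n, ∀ h l, Convex ℝ (D b h l))
    {δr : ℕ → ℝ} (hδr : ∀ b, 0 < δr b)
    {Tm : ℕ → Type*} [∀ b, Fintype (Tm b)]
    (supp : (b : ℕ) → (Π i : Iic b, X i) → Tm b → Finset (Λ b))
    (Fc : (b : ℕ) → (Π i : Iic b, X i) → Tm b → (Λ b → ℂ) → ℂ)
    (hdep : ∀ b < n, ∀ h t, DepOn (supp b h t) (Fc b h t))
    (hhol : ∀ b < n, ∀ h t, ∀ ζ ∈ cthick (D b h) (fun _ => δr b), ∀ l ∈ supp b h t,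
      DifferentiableAt ℂ (fun w => Fc b h t (update ζ l w)) (ζ l))
    {mX : (b : ℕ) → (Π i : Iic b, X i) → Tm b → ℝ} (hmX0 : ∀ b < n, ∀ h t, 0 ≤ mX b h t)
    (hmX : ∀ b < n, ∀ h t, ∀ ζ ∈ cthick (D b h) (fun _ => δr b), ‖Fc b h t ζ‖ ≤ mX b h t)
    (Pres : (b : ℕ) → (Π i : Iic b, X i) → (Λ b → ℝ) → ℝ)
    (HR : (b : ℕ) → (Π i : Iic b, X i) → Λ b → Λ b → ℝ)
    (hHR0 : ∀ b < n, ∀ h l l', 0 ≤ HR b h l l')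
    (hHRdom : ∀ b < n, ∀ h, PairDomOn (D b h) (Pres b h) (HR b h))
    {HsR : ℕ → ℝ} (hHsR0 : ∀ b, 0 ≤ HsR b) (hHsR : ∀ b < n, ∀ h l', ∑ l, HR b h l l' ≤ HsR b)
    {GR : (b : ℕ) → (Π i : Iic b, X i) → Λ b → ℝ}
    (hGR : ∀ b < n, ∀ h, LipOn (D b h) (Pres b h) (GR b h))
    {gR : ℕ → ℝ} (hgR : ∀ b, 0 ≤ gR b) (hGRg : ∀ b < n, ∀ h l, GR b h l ≤ gR b)
    (hexp : ∀ b < n, ∀ h ξ, (∀ l, ξ l ∈ D b h l) →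
      Praw b h ξ = ∑ t, (Fc b h t (toC ξ)).re + Pres b h ξ)
    {ms1 ms2 : ℕ → ℝ} (hms1 : ∀ b, 0 ≤ ms1 b) (hms2 : ∀ b, 0 ≤ ms2 b)
    (hm1 : ∀ b < n, ∀ h l, ∑ t, (if l ∈ supp b h t then mX b h t else 0) ≤ ms1 b)
    (hm2 : ∀ b < n, ∀ h l',
      ∑ t, (if l' ∈ supp b h t then ((supp b h t).card : ℝ) * mX b h t else 0) ≤ ms2 b)
    -- raw ES sensitivities, verbatim
    {c : (b : ℕ) → (Π i : Iic b, X i) → Λ b → ℝ}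
    (hc : ∀ b < n, ∀ h, LipOn (D b h) (fun ξ => fiberMean κ' (b + 1) φ (succGlue b (h, T b h ξ)))
      (c b h))
    -- (W1′) on the torus: site data, coercivity, localisation in the torus distance, locality
    {d : ℕ} {Pv : ℕ → Fin d → ℕ} (hPv : ∀ b i, 1 ≤ Pv b i)
    (Ω : (b : ℕ) → Finset (TSite d (Pv b))) (N₀ : ℕ)
    (emb : (b : ℕ) → Λ b → TIdx (Pv b) (Ω b) N₀) (hemb : ∀ b, Injective (emb b))
    {γ κ ρ N βr βc : ℝ} (hργ : ρ < γ) (hκ : 0 < κ)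
    (hcoer : ∀ b < n, ∀ h, Coercive ((Bm b h)ᵀ * Bm b h) γ)
    (hMrow : ∀ b < n, ∀ h (i : Λ b),
      ∑ j, |((Bm b h)ᵀ * Bm b h) i j| * (Real.exp (κ * embDist (emb b) i j) - 1) ≤ ρ)
    (hMcol : ∀ b < n, ∀ h (j : Λ b),
      ∑ i, |((Bm b h)ᵀ * Bm b h) i j| * (Real.exp (κ * embDist (emb b) i j) - 1) ≤ ρ)
    (hNK : (N₀ : ℝ) * B4Sect5Proof.latticeConst d κ ≤ N)
    (hβr : 0 ≤ βr) (hBr : ∀ b < n, ∀ h (i : ι b), ∑ l, |Bm b h i l| ≤ βr)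
    (hβc : 0 ≤ βc) (hBc : ∀ b < n, ∀ h (l : Λ b), ∑ i, |Bm b h i l| ≤ βc)
    -- smallness of the transported constants
    {α₀ : ℝ} (hα₀ : α₀ < 1)
    (hα : ∀ b, 4 * p b ^ 2 *
      (((γ - ρ)⁻¹ * N * βc) * ((γ - ρ)⁻¹ * N * βr) * (4 * ms2 b / δr b ^ 2 + HsR b)) ≤ α₀)
    {ω : ℝ} (hω0 : 0 ≤ ω)
    (hωb : ∀ b, 2 * p b * ((ms1 b / δr b + gR b) * ((γ - ρ)⁻¹ * N * βr)) ≤ ω)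
    -- measurability / boundedness side conditions and the graded-geometric profile, verbatim
    (hWm : ∀ b, StronglyMeasurable (fun h => ∑ l, c b h l ^ 2)) {CW : ℝ}
    (hWb : ∀ b h, |∑ l, c b h l ^ 2| ≤ CW)
    (Mf : (b : ℕ) → Finset (Λ b)) {C κ₁ Etot : ℝ} (hκ₁ : 1 ≤ κ₁) {Θ : ℕ → ℝ}
    {J : ℕ → Type*} (Jset : (b : ℕ) → Λ b → Finset (J b))
    {Aev : (b : ℕ) → Λ b → J b → Set (Π i : Iic b, X i)}
    (hA : ∀ b < n, ∀ l ∈ Mf b, ∀ j ∈ Jset b l, MeasurableSet (Aev b l j))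
    (hc0 : ∀ b < n, ∀ h, ∀ l ∉ Mf b, c b h l = 0)
    (hcg : ∀ b < n, ∀ h, ∀ l ∈ Mf b,
      |c b h l| ≤ C * Θ b * κ₁ ^ ((Jset b l).filter fun j => h ∈ Aev b l j).card)
    {ε : (b : ℕ) → Λ b → J b → ℝ} (hε : ∀ b < n, ∀ l ∈ Mf b, ∀ j ∈ Jset b l, 0 ≤ ε b l j)
    (hE : ∀ b < n, ∀ l ∈ Mf b, ∑ j ∈ Jset b l, ε b l j ≤ Etot)
    (hdomA : ∀ b < n, ∀ l ∈ Mf b, ∀ S' ⊆ Jset b l,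
      μ.real (⋂ j ∈ S', {x | frestrictLe b x ∈ Aev b l j}) ≤ μ.real Set.univ * ∏ j ∈ S', ε b l j)
    {P r : ℝ} (hP : 0 ≤ P) (hr0 : 0 ≤ r) (hr1 : r < 1)
    (hgeo : ∀ b, ((Mf b).card : ℝ) * (Θ b ^ 2 * (Real.exp ω * (2 * v + 2 * p b ^ 2))) ≤ P * r ^ b) :
    ∫ x, (φ x - towerMean κ' φ (x 0)) ^ 2 ∂μ ≤
      (1 / (1 - α₀)) * ((1 / 2 : ℝ) * (C ^ 2 * (((γ - ρ)⁻¹ * N * βc) * ((γ - ρ)⁻¹ * N * βr))) *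
        (μ.real Set.univ * Real.exp ((κ₁ ^ 2 - 1) * Etot)) * (P / (1 - r))) := by
  -- the raw pair dominator and the raw Lipschitz vector produced by the Cauchy estimates
  let H : (b : ℕ) → (Π i : Iic b, X i) → Λ b → Λ b → ℝ := fun b h l l' =>
    (∑ t, if l ∈ supp b h t ∧ l' ∈ supp b h t then 4 * mX b h t / (δr b * δr b) else 0) +
      HR b h l l'
  let G : (b : ℕ) → (Π i : Iic b, X i) → Λ b → ℝ := fun b h l =>
    (∑ t, if l ∈ supp b h t then mX b h t / δr b else 0) + GR b h l
  have hδ0 : ∀ b, (0 : ℝ) ≤ δr b := fun b => (hδr b).le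
  -- (W2″): nonnegativity, domination, column sums
  have hH0 : ∀ b < n, ∀ h l l', 0 ≤ H b h l l' := by
    intro b hb h l l'
    refine add_nonneg (Finset.sum_nonneg fun t _ => ?_) (hHR0 b hb h l l')
    split_ifs
    · exact div_nonneg (mul_nonneg (by norm_num) (hmX0 b hb h t)) (mul_nonneg (hδ0 b) (hδ0 b))
    · exact le_rfl
  have hHdom : ∀ b < n, ∀ h, PairDomOn (D b h) (Praw b h) (H b h) := by
    intro b hb h
    have hsum : PairDomOn (D b h) (fun ξ => ∑ t, (Fc b h t (toC ξ)).re)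
        (fun l l' => ∑ t,
          if l ∈ supp b h t ∧ l' ∈ supp b h t then 4 * mX b h t / (δr b * δr b) else 0) := by
      refine pairDomOn_finset_sum _ fun t _ => ?_
      exact pairDomOn_re_of_sliceHol_depOn (hdep b hb h t) (hDc b hb h) (fun _ => hδr b)
        (hhol b hb h t) (hmX b hb h t)
    exact pairDomOn_congr (hsum.add (hHRdom b hb h)) fun ξ hξ => (hexp b hb h ξ hξ).symm
  have hHs0 : ∀ b, 0 ≤ 4 * ms2 b / δr b ^ 2 + HsR b := fun b =>
    add_nonneg (div_nonneg (mul_nonneg (by norm_num) (hms2 b)) (pow_nonneg (hδ0 b) 2)) (hHsR0 b)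
  have hHs : ∀ b < n, ∀ h l', ∑ l, H b h l l' ≤ 4 * ms2 b / δr b ^ 2 + HsR b := by
    intro b hb h l'
    have e1 : ∀ t, (if l' ∈ supp b h t then
        ((supp b h t).card : ℝ) * (4 * mX b h t / (δr b * δr b)) else 0) =
        4 / (δr b * δr b) *
          (if l' ∈ supp b h t then ((supp b h t).card : ℝ) * mX b h t else 0) := by
      intro t
      split_ifs
      · ring
      · ring
    have hloc : ∑ l, ∑ t,
        (if l ∈ supp b h t ∧ l' ∈ supp b h t then 4 * mX b h t / (δr b * δr b) else 0) ≤
        4 * ms2 b / δr b ^ 2 := by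
      calc ∑ l, ∑ t,
            (if l ∈ supp b h t ∧ l' ∈ supp b h t then 4 * mX b h t / (δr b * δr b) else 0)
          = ∑ t, ∑ l,
            (if l ∈ supp b h t ∧ l' ∈ supp b h t then 4 * mX b h t / (δr b * δr b) else 0) :=
            Finset.sum_comm
        _ = ∑ t, (if l' ∈ supp b h t then
              ((supp b h t).card : ℝ) * (4 * mX b h t / (δr b * δr b)) else 0) :=
            Finset.sum_congr rfl fun t _ => sum_ite_and_mem (supp b h t) _ l'
        _ = ∑ t, 4 / (δr b * δr b) *
              (if l' ∈ supp b h t then ((supp b h t).card : ℝ) * mX b h t else 0) :=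
            Finset.sum_congr rfl fun t _ => e1 t
        _ = 4 / (δr b * δr b) *
              ∑ t, (if l' ∈ supp b h t then ((supp b h t).card : ℝ) * mX b h t else 0) := by
            rw [Finset.mul_sum]
        _ ≤ 4 / (δr b * δr b) * ms2 b :=
            mul_le_mul_of_nonneg_left (hm2 b hb h l')
              (div_nonneg (by norm_num) (mul_nonneg (hδ0 b) (hδ0 b)))
        _ = 4 * ms2 b / δr b ^ 2 := by rw [pow_two]; ring
    calc ∑ l, H b h l l'
        = ∑ l, ∑ t, (if l ∈ supp b h t ∧ l' ∈ supp b h t then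
              4 * mX b h t / (δr b * δr b) else 0) + ∑ l, HR b h l l' :=
          Finset.sum_add_distrib
      _ ≤ 4 * ms2 b / δr b ^ 2 + HsR b := add_le_add hloc (hHsR b hb h l')
  -- (W3″): Lipschitz vector, bound
  have hG : ∀ b < n, ∀ h, LipOn (D b h) (Praw b h) (G b h) := by
    intro b hb h
    have hsum : LipOn (D b h) (fun ξ => ∑ t, (Fc b h t (toC ξ)).re)
        (fun l => ∑ t, if l ∈ supp b h t then mX b h t / δr b else 0) := by
      refine lipOn_finset_sum _ fun t _ => ?_
      exact lipOn_re_of_sliceHol_depOn (hdep b hb h t) (hDc b hb h) (fun _ => hδr b)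
        (hhol b hb h t) (hmX b hb h t)
    exact lipOn_congr (lipOn_add hsum (hGR b hb h)) fun ξ hξ => (hexp b hb h ξ hξ).symm
  have hg : ∀ b, 0 ≤ ms1 b / δr b + gR b := fun b =>
    add_nonneg (div_nonneg (hms1 b) (hδ0 b)) (hgR b)
  have hGg : ∀ b < n, ∀ h l, G b h l ≤ ms1 b / δr b + gR b := by
    intro b hb h l
    have e1 : ∀ t, (if l ∈ supp b h t then mX b h t / δr b else 0) =
        (if l ∈ supp b h t then mX b h t else 0) / δr b := by
      intro t
      split_ifs
      · rfl
      · rw [zero_div]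
    have hloc : ∑ t, (if l ∈ supp b h t then mX b h t / δr b else 0) ≤ ms1 b / δr b := by
      rw [Finset.sum_congr rfl fun t _ => e1 t, ← Finset.sum_div]
      exact div_le_div_of_nonneg_right (hm1 b hb h l) (hδ0 b)
    exact add_le_add hloc (hGRg b hb h l)
  exact integral_sq_sub_towerMean_le_of_graded_geometric_rawInteraction_torus_pathLaw μ κ' hκ' n
    hφn hφR hT m Bm he hep π hv0 hv hD Praw hPm hPb hrep H hH0 hHdom
    (Hs := fun b => 4 * ms2 b / δr b ^ 2 + HsR b) hHs0 hHs (G := G) hG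
    (g := fun b => ms1 b / δr b + gR b) hg hGg hc hPv Ω N₀ emb hemb hργ hκ hcoer hMrow hMcol
    hNK hβr hBr hβc hBc hα₀ hα hω0 hωb hWm hWb Mf hκ₁ Jset hA hc0 hcg hε hE hdomA hP hr0 hr1 hgeo

end EndToEnd

end Literature.MathematicalPhysics.QuantumFieldTheory.Balaban1983to89.T4InteractionCauchy
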